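import Summits.ValiantsHypothesis.ValiantsHypothesis.Theorems.FifoMatchingNNDivisionHardShadowConstReadGeneric

/-!
(SUPPLEMENT — PART 8, pressed after part 7 `…ShadowConstReadGeneric` — §5h species TEN ⊆ the landed class `LocatedRows.PinExposed`)
# SHADOW-CONSTANT READ / TWIN ROWS — the s-top / distinct-`S`-block species are PIN-EXPOSED

Theorems-side port (staged by val-idea-41 g4; press as `Theorems/FifoMatchingNNDivisionHardShadowConstReadTenPinned.lean`,
`--kind proof --supports stmt-ValiantsHypothesis-21181 --as helper`) of §5h of the crux workfile
`Cruxes/NNDivisionHard/ShadowConstRead41.lean` REV 13 @6f612840a212 (sha16 05063dd1d6087d34, 1742 l.; farm rc 0 / 0 sorries / 0 warnings,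
axioms standard), requested by the line's pen (val-port 01:25:19Z (2)) and the critic (val-idea-crit-9 g3 V#101b: «TEN ⊆ PinLocated … on paper
in two lines; a ≤ 60-line kernel lemma `sTop_pinExposed : (s-top data) → LocatedRows.PinExposed n K q`»).  Namespace
`Summit.ValiantsHypothesis.ValiantsHypothesis.Theorems.FifoMatching.ShadowConstRead`; the class `PinExposed` and the frame (`hCOR`,
`exists_eq_hCOR`, `flat_le_hCOR`) are the tree's `…Theorems.FifoMatching.LocatedRows` ones BY NAME; `flat_nonneg_dot_le`,
`flat_supported_dot_eq` (part 5) and `exists_separating_pin` (part 7) are this port's.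

CONTENT: `sTop_pinExposed` — an entrywise-nonnegative `P` supported on `S × S` (`2|S| ≤ n`) whose functional `⟨flat P, ·⟩` has a strict
unique top `j⋆` among the listed points gives `PinExposed n K q` with the pin `flat (c • P)`, `c = Σ_j Σ_a |udRow a ⬝ (q_j − q_{j⋆})| / gap_j`
(VALID on `COR(n)` by `flat_le_hCOR` + `flat_nonneg_dot_le`, TIGHT-UP on `b ⊇ S` by `flat_supported_dot_eq`, and `c·gap_j` dominates every
clique-part difference); `distinctS_pinExposed` — on a twin frame, pairwise distinct `S × S` blocks ⇒ `PinExposed` (separating moment pin).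
So the species of `sTop_decided` / `distinctS_decided` lie inside the landed class `PinExposed` (decided by `pinExposed_decided`,
`exactTilted_law_on_pinExposed`): census bookkeeping, no new disjunct.

HONEST LABEL: support lemmas about CLASSES of passengers for an OPEN crux; `ExactPencilLaw` (C′) ⟺ COR-VIRTUAL (`…ExactIsVirtual`),
21181 `NNDivisionHard` are OPEN.  VP ≠ VNP is NOT proved here or anywhere in this tree.
-/

set_option autoImplicit false

-- the mandated summit-side namespace repeats a component by design (single-problem summit)
set_option linter.dupNamespace false

noncomputable section

namespace Summit.ValiantsHypothesis.ValiantsHypothesis.Theorems.FifoMatching.ShadowConstRead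

open Matrix Finset
open Literature.Barriers.PneNP (HasEFOfSize three_pow_le_card_mul_two_pow_of_cover_univ)
open Literature.Combinatorics.Optimization.FixedSizePsdRank (Cube bvec flat vecOuter corPolytope flat_dotProduct_vecOuter
  flat_dotProduct_le_of_mem_corPolytope)
open Summit.ValiantsHypothesis.ValiantsHypothesis.Theorems.FifoMatching.XcDivision
  (udInd udPt udRow udMat udInd_apply udInd_sq udInd_inter ud_data udRow_dotProduct_flat_diagonal flat_dotProduct_flat)
open Summit.ValiantsHypothesis.ValiantsHypothesis.Theorems.FifoMatching.GridCorShadow (four_T_lt_two_pow)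
open Summit.ValiantsHypothesis.ValiantsHypothesis.Theorems.FifoMatching.LocatedRows
  (T RowFamily three_pow_le_of_block two_pow_half_mul_le T_lt_of_block' hCOR le_hCOR exists_eq_hCOR flat_le_hCOR exactTilted ExactPencilLaw
    concl_of_lawBody CorVirtualHardN corVirtualHardN_of_exactPencilLaw sum_mul_udInd flat_dotProduct_udPt_eq PinExposed)
open scoped Pointwise

section Part8
variable {n : ℕ}

/-- ★ s-top data are pin-exposed data (TEN's lever ⊆ CLASS P): a nonnegative `P` supported on `S × S`, `2|S| ≤ n`, whose functional
`⟨flat P, ·⟩` has a STRICT unique top `j⋆` among the listed points, yields `LocatedRows.PinExposed n K q` with the pin `flat (c • P)`. -/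
theorem sTop_pinExposed {K : ℕ} (q : Fin (K + 1) → (Fin (n * n) → ℝ)) (S : Finset (Fin n)) (hS : 2 * S.card ≤ n)
    (P : Matrix (Fin n) (Fin n) ℝ) (hP0 : ∀ x y, 0 ≤ P x y) (hPS : ∀ x y, P x y ≠ 0 → x ∈ S ∧ y ∈ S)
    (js : Fin (K + 1)) (htop : ∀ j, j ≠ js → flat P ⬝ᵥ q j < flat P ⬝ᵥ q js) : PinExposed n K q := by
  classical
  -- the gaps (dummy value `1` at `j⋆`) and the dominating constant
  let gap : Fin (K + 1) → ℝ := fun j => if j = js then 1 else flat P ⬝ᵥ q js - flat P ⬝ᵥ q j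
  have hgap_pos : ∀ j, 0 < gap j := by
    intro j
    by_cases hj : j = js
    · simp [gap, hj]
    · have := htop j hj
      simp only [gap, if_neg hj]
      linarith
  have hgap_of_ne : ∀ j, j ≠ js → gap j = flat P ⬝ᵥ q js - flat P ⬝ᵥ q j := fun j hj => by simp [gap, hj]
  let c : ℝ := ∑ j, ∑ a : Finset (Fin n), |udRow a ⬝ᵥ q j - udRow a ⬝ᵥ q js| / gap j
  have hc0 : 0 ≤ c :=
    Finset.sum_nonneg fun j _ => Finset.sum_nonneg fun a _ => div_nonneg (abs_nonneg _) (hgap_pos j).le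
  have hkey : ∀ (a : Finset (Fin n)) (j : Fin (K + 1)), j ≠ js →
      udRow a ⬝ᵥ q j - udRow a ⬝ᵥ q js ≤ c * (flat P ⬝ᵥ q js - flat P ⬝ᵥ q j) := by
    intro a j hj
    have hg := hgap_of_ne j hj
    have hgp : 0 < flat P ⬝ᵥ q js - flat P ⬝ᵥ q j := by rw [← hg]; exact hgap_pos j
    have h1 : |udRow a ⬝ᵥ q j - udRow a ⬝ᵥ q js| / gap j ≤ c := by
      calc |udRow a ⬝ᵥ q j - udRow a ⬝ᵥ q js| / gap j
          ≤ ∑ a' : Finset (Fin n), |udRow a' ⬝ᵥ q j - udRow a' ⬝ᵥ q js| / gap j :=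
            Finset.single_le_sum (f := fun a' : Finset (Fin n) => |udRow a' ⬝ᵥ q j - udRow a' ⬝ᵥ q js| / gap j)
              (fun a' _ => div_nonneg (abs_nonneg _) (hgap_pos j).le) (Finset.mem_univ a)
        _ ≤ c := Finset.single_le_sum (f := fun j' : Fin (K + 1) =>
              ∑ a' : Finset (Fin n), |udRow a' ⬝ᵥ q j' - udRow a' ⬝ᵥ q js| / gap j')
              (fun j' _ => Finset.sum_nonneg fun a' _ => div_nonneg (abs_nonneg _) (hgap_pos j').le) (Finset.mem_univ j)
    rw [hg] at h1
    calc udRow a ⬝ᵥ q j - udRow a ⬝ᵥ q js ≤ |udRow a ⬝ᵥ q j - udRow a ⬝ᵥ q js| := le_abs_self _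
      _ = |udRow a ⬝ᵥ q j - udRow a ⬝ᵥ q js| / (flat P ⬝ᵥ q js - flat P ⬝ᵥ q j) * (flat P ⬝ᵥ q js - flat P ⬝ᵥ q j) := by
          field_simp
      _ ≤ c * (flat P ⬝ᵥ q js - flat P ⬝ᵥ q j) := mul_le_mul_of_nonneg_right h1 hgp.le
  -- the scaled pin
  have hcP0 : ∀ x y, 0 ≤ (c • P) x y := fun x y => by
    simpa [Matrix.smul_apply, smul_eq_mul] using mul_nonneg hc0 (hP0 x y)
  have hcPS : ∀ x y, (c • P) x y ≠ 0 → x ∈ S ∧ y ∈ S := fun x y h => hPS x y fun h0 => h (by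
    simp [Matrix.smul_apply, h0])
  have hsm : flat (c • P) = c • flat P := by
    funext p
    simp [flat, Matrix.smul_apply, smul_eq_mul]
  refine ⟨S, flat (c • P), js, hS, ?_, ?_, ?_⟩
  · -- VALID on `COR(n)`
    intro x hx
    obtain ⟨b, hb⟩ := exists_eq_hCOR (c • P)
    have h1 := flat_le_hCOR (c • P) x hx
    rw [← hb] at h1
    exact h1.trans (flat_nonneg_dot_le (c • P) S hcP0 hcPS b)
  · -- TIGHT-UP on columns `b ⊇ S`
    intro b hb
    exact flat_supported_dot_eq (c • P) S hcPS b hb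
  · -- `j⋆` maximises every pinned row (for ALL `a`, not only `a ⊆ Sᶜ`)
    intro a _ j
    by_cases hj : j = js
    · rw [hj]
    · have hk := hkey a j hj
      rw [hsm, add_dotProduct, add_dotProduct, smul_dotProduct, smul_dotProduct, smul_eq_mul, smul_eq_mul]
      nlinarith [hk, mul_sub c (flat P ⬝ᵥ q js) (flat P ⬝ᵥ q j)]

/-- ★ SPECIES TEN ⊆ CLASS P: on a twin frame (`ι₁, ι₂ : Fin k ↪ Fin n` with disjoint images, so `2k ≤ n`), pairwise distinct
`S × S` blocks of the listed points (`S = ι₂[Fin k]`) give `LocatedRows.PinExposed` — via the separating moment pin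
(`exists_separating_pin`) and `sTop_pinExposed`.  (So `distinctS_decided` is also a corollary of the landed `pinExposed_decided` /
`exactTilted_law_on_pinExposed`, up to the block-size bookkeeping.) -/
theorem distinctS_pinExposed {k : ℕ} (ι₁ ι₂ : Fin k ↪ Fin n) (hι : ∀ i j, ι₁ i ≠ ι₂ j) {K : ℕ}
    (Qm : Fin (K + 1) → Matrix (Fin n) (Fin n) ℝ)
    (hdis : ∀ j j', j ≠ j' → ∃ x ∈ (Finset.univ : Finset (Fin k)).map ι₂, ∃ y ∈ (Finset.univ : Finset (Fin k)).map ι₂,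
      Qm j x y ≠ Qm j' x y) :
    PinExposed n K (fun j => flat (Qm j)) := by
  classical
  obtain ⟨P, hP0, hPS, hinj⟩ := exists_separating_pin ((Finset.univ : Finset (Fin k)).map ι₂) Qm hdis
  obtain ⟨js, -, hjs⟩ := Finset.exists_max_image (Finset.univ : Finset (Fin (K + 1)))
    (fun j => flat P ⬝ᵥ flat (Qm j)) ⟨0, Finset.mem_univ _⟩
  have h2k : 2 * ((Finset.univ : Finset (Fin k)).map ι₂).card ≤ n := by
    rw [Finset.card_map, Finset.card_univ, Fintype.card_fin]
    have hdisj : Disjoint ((Finset.univ : Finset (Fin k)).map ι₁) ((Finset.univ : Finset (Fin k)).map ι₂) := by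
      rw [Finset.disjoint_left]
      intro x hx₁ hx₂
      rw [Finset.mem_map] at hx₁ hx₂
      obtain ⟨i, -, rfl⟩ := hx₁
      obtain ⟨j, -, hj⟩ := hx₂
      exact hι i j hj.symm
    have hcard := Finset.card_le_univ (((Finset.univ : Finset (Fin k)).map ι₁) ∪ ((Finset.univ : Finset (Fin k)).map ι₂))
    rw [Finset.card_union_of_disjoint hdisj, Finset.card_map, Finset.card_map, Finset.card_univ, Fintype.card_fin,
      Fintype.card_fin] at hcard
    omega
  exact sTop_pinExposed (fun j => flat (Qm j)) _ h2k P hP0 hPS js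
    (fun j hj => lt_of_le_of_ne (hjs j (Finset.mem_univ _)) (fun h => hj (hinj h)))

end Part8

end Summit.ValiantsHypothesis.ValiantsHypothesis.Theorems.FifoMatching.ShadowConstRead
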